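import Literature.Analysis.FluidPDE.QuasiSelfSimilarMoveSP03
import HarnessLib

/-!
# Straight move, phase 3: re-description certificates towards phase 4

Topic `Literature/Analysis/FluidPDE`. Emitted data / kernel certificates of the explicit straight generating
move (`S`) in the typed-chain model, under the contract of `PlanarGeneratorAssembly.lean`
(`acm_compatible_blocks_of_slots`). Generated by the author's emitter from the exact rational design;
no named facts, every theorem is decided in the kernel or assembled from decided chunks. [folklore]

## References

* G. Alberti, G. Crippa, A. L. Mazzucato, *Exponential self-similar mixing by incompressible
  flows*, J. Amer. Math. Soc. 32 (2019), 445–490, §8 (arXiv:1605.02090).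
-/

noncomputable section

namespace Literature.Analysis.FluidPDE.QuasiSelfSimilar.MoveS

open PlanarKinematics QuasiSelfSimilar

/-- Cover certificate of the end keyframe of phase 3 by the start keyframe of phase 4. [folklore] -/
def rc03 : List (Fin 2 × List (ℕ × EquivCert)) := [(0, [(0, .same)]), (0, [(1, .same)]), (0, [(2, .same)]), (0, [(3, .same)]), (0, [(4, .same)]), (1, [(5, .same), (6, .same), (7, .same)]), (0, [(8, .same)]), (0, [(9, .same)]), (0, [(10, .same)]), (0, [(11, .same)]), (0, [(12, .same)]), (1, [(18, .same), (17, (.gap 0 0 0 0 (mkRat (-4541) 4500) (mkRat (-4441) 4500))), (16, (.gap 0 0 0 0 (mkRat (-4631) 4500) (mkRat (-4531) 4500))), (15, .same), (14, .same), (13, .same)]), (0, [(19, .same)]), (0, [(20, .same)]), (0, [(21, .same)]), (0, [(22, .same)]), (0, [(23, .same)]), (1, [(29, .same), (28, .same), (27, .same), (26, (.gap 0 0 0 0 (mkRat (-4469) 4500) (mkRat (-4369) 4500))), (25, (.gap 0 0 0 0 (mkRat (-4559) 4500) (mkRat (-4459) 4500))), (24, .same)]), (0, [(30, .same)]), (0,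 [(31, .same)]), (0, [(32, .same)]), (0, [(33, .same)]), (0, [(34, .same)]), (1, [(35, .same), (36, .same), (37, .same)]), (0, [(38, .same)]), (0, [(39, .same)]), (0, [(40, .same)]), (0, [(41, .same)]), (0, [(42, .same)])]

/-- Cover certificate of the start keyframe of phase 4 by the end keyframe of phase 3. [folklore] -/
def rc03' : List (Fin 2 × List (ℕ × EquivCert)) := [(0, [(0, .same)]), (0, [(1, .same)]), (0, [(2, .same)]), (0, [(3, .same)]), (0, [(4, .same)]), (1, [(5, .same)]), (1, [(5, .same)]), (1, [(5, .same)]), (0, [(6, .same)]), (0, [(7, .same)]), (0, [(8, .same)]), (0, [(9, .same)]), (0, [(10, .same)]), (1, [(11, .same)]), (1, [(11, .same)]), (1, [(11, .same)]), (0, [(11, (.gap 0 0 0 0 (mkRat (-5473) 9000) (mkRat (-5291) 9000)))]), (0, [(11, (.gap 0 0 0 0 (mkRat (-5293) 9000) (mkRat (-5111) 9000)))]), (1, [(11, .same)]), (0, [(12, .same)]), (0, [(13, .same)]), (0, [(14, .same)]), (0, [(15, .same)]), (0, [(16, .same)]), (1, [(17, .same)]), (0, [(17, (.gap 0 0 0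 0 (mkRat (-3889) 9000) (mkRat (-3707) 9000)))]), (0, [(17, (.gap 0 0 0 0 (mkRat (-3709) 9000) (mkRat (-3527) 9000)))]), (1, [(17, .same)]), (1, [(17, .same)]), (1, [(17, .same)]), (0, [(18, .same)]), (0, [(19, .same)]), (0, [(20, .same)]), (0, [(21, .same)]), (0, [(22, .same)]), (1, [(23, .same)]), (1, [(23, .same)]), (1, [(23, .same)]), (0, [(24, .same)]), (0, [(25, .same)]), (0, [(26, .same)]), (0, [(27, .same)]), (0, [(28, .same)])]

end Literature.Analysis.FluidPDE.QuasiSelfSimilar.MoveS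

end
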